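import Summits.HubbardSuperconductivity.HubbardSuperconductivity.Theorems.SeamGluingLocality.Negative.ZeroCouplingDegeneracy

/-!
# `SeamGluingLocality` (stmt-HubbardSuperconductivity-18509), negative side: at zero coupling even the
# SIGN-GUARDED compressibility comparison fails — compressible parts glue into a degenerate tube

`ZeroCouplingDegeneracy.lean` refutes the `U := 0` twin of the crux through its hidden exact-degeneracy
claim (parts with `ẽ″ = 0`, glued tube with `ẽ″ > 0`): a witness that the guarded restatements of the
crux (`0 < min(ẽ″', ẽ″'')` as a hypothesis of the compressibility comparisons — the "comparison-only,
positive parts" gloss of the item) deliberately exclude. This file removes that objection. It proves,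
sorry-free and again without any closed-form Fermi sea, that at `U = 0` the compressibility comparison
fails WITH THE GUARD ACTIVE, cofinally in all sizes:

* `exists_closedShell_cell_half` / `exists_delta_closedShells_half` — a nested-cell construction of ONE
  doping `δ ∈ (0, 3/10)` such that for cofinally many `L ≡ 0 (mod 4)` the pair number `⌊(1-δ)L²/4⌋`
  of the HALF-WIDTH tube `L × L/2` is a closed-shell count `n` of its free band, with the finer pinning
  `(1-δ)L²/4 ∈ [n + 1/8, n + 3/8]` (so the square torus `L × L` at the same `δ` holds EXACTLY `2n`
  pairs);
* `exists_cofinal_zero_coupling_guardedCompressibilityFailure` — at that `δ`, beyond every threshold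
  pair `(M₂, L₂)`: both parts `L × L/2` sit on a CLOSED shell (`ẽ″' = ẽ″'' > 0`,
  `tubePairCompressibility_zero_coupling_pos_of_closedShell`) while the glued square torus `L × L`, with
  the EVEN pair number `2n`, sits on an OPEN shell (`ẽ″ = 0`: cumulative shell counts of an even × even
  free torus are odd, `tubePairCompressibility_zero_coupling_eq_zero_of_even`);
* **`guardedCompressibilityLocality_false_at_zero_coupling`** — hence the sign-guarded lower
  compressibility comparison `0 < min(ẽ″', ẽ″'') → (1 - M₂/M)·min(ẽ″', ẽ″'') ≤ ẽ″_M` (conjunct (2) of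
  the crux with its guard made explicit; the compressibility half of the guarded repair shape "C‴" of
  the verdict notes on the item) is FALSE at `U = 0`, whatever `(M₂, L₂)`;
* `not_guardedCompressibilityLocality_fromZeroU` — the same with a leading `∀ U, 0 ≤ U →`.

Reading (for the tenure planner). The failure of the crux at `U = 0` is NOT an artefact of its hidden
sign/degeneracy claims: locality of a POSITIVE free pair compressibility under gluing is itself false
(at `U = 0`, `ẽ″` is a shell quantity, `LM·gap/2` or `0`, reshuffled completely by one seam). So a
guard-only repair of stmt-18509 is refuted at zero coupling exactly like the original; what makes the
restated crux consistent at `U → 0⁺` are its per-width FLOOR HYPOTHESES at the same `(U, δ)`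
(`d ≤ ρ̃`, `d ≤ ẽ″ ≤ k` eventually in `L` at fixed width — false at `U = 0` by the
`ZeroCouplingCompressibility` negatives of stmt-18510/16312, so both restatement shapes
`CondAdditiveLocality` / floored-multiplicative are vacuous there), together with thresholds
`m₀(U,δ,d,k), L₂(U,δ,d,k) → ∞` as `U → 0⁺`. Any proof of any restatement must therefore use `0 < U`
through those floors. The crux itself (`0 < U`) is untouched. Folklore (free-electron shell structure;
D. J. Scalapino, S. R. White, S. C. Zhang, PRB 47 (1993) 7995 §II). No definitions, no named facts.
REUSED: `le_card_filter_tubeBand_neg`, `card_filter_tubeBand_eq_le`, `exists_closedShell_le`,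
`neg_four_le_tubeBand`, `tubeBand_zero_zero`, the two `tubePairCompressibility_zero_coupling_…` lemmas.
-/

noncomputable section

namespace Summit.HubbardSuperconductivity.HubbardSuperconductivity.Theorems.SeamGluingLocality.Negative

set_option linter.dupNamespace false -- summit = problem name (single-conjunct summit), D-0017

open scoped BigOperators Classical
open Finset Summit.HubbardSuperconductivity.HubbardSuperconductivity.Theorems.WidthHaldane
open Summit.HubbardSuperconductivity.HubbardSuperconductivity.Theorems.WidthUniformThermodynamics.Negative
open Summit.HubbardSuperconductivity.HubbardSuperconductivity.Theorems.PerWidthThermodynamics.Negative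

/-! ### One closed-shell doping cell of the half-width tube, cofinally in `L` -/

section Cell

set_option maxHeartbeats 400000 in -- buildfix 2026-08-19: the proof sits at the default budget (~200k measured)
/-- **A closed-shell cell of the half-width tube.** Inside every doping window `(α, β) ⊂ (0, 3/10)`
and beyond every length threshold `L₀` there are `L ≡ 0 (mod 4)`, `L ≥ 8`, a closed cell
`[lo, hi] ⊂ (α, β)` and a closed shell `n = #{ε_{L,L/2} ≤ μ}` of the free `L × L/2` tube below half
filling (`-4 ≤ μ < 0`) such that every doping `δ ∈ [lo, hi]` has `(1-δ)·L·(L/2)/2 ∈ [n + 1/8, n + 3/8]`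
(so the pair number of the `L × L/2` tube is `n` and that of the square torus `L × L` is exactly `2n`):
as `δ` sweeps `(α, β)` the target sweeps more than `2L + 2` integers below `#{ε < 0} ≥ L²/4 - L`, and
a closed-shell count occurs in every run of `2L` of them (`exists_closedShell_le`, multiplicity `≤ 2L`,
`card_filter_tubeBand_eq_le`). [folklore] -/
theorem exists_closedShell_cell_half {α β : ℝ} (hα : 0 < α) (hαβ : α < β) (hβ : β < 3 / 10) (L₀ : ℕ) :
    ∃ (L : ℕ) (_ : NeZero L) (_ : NeZero (L / 2)), L₀ ≤ L ∧ 4 ∣ L ∧ 8 ≤ L ∧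
      ∃ lo hi : ℝ, α < lo ∧ lo < hi ∧ hi < β ∧
      ∃ (n : ℕ) (μ : ℝ), μ < 0 ∧ -4 ≤ μ ∧
        (univ.filter fun k : ZMod L × ZMod (L / 2) => tubeBand L (L / 2) k ≤ μ).card = n ∧
        ∀ δ ∈ Set.Icc lo hi, (n : ℝ) + 1 / 8 ≤ (1 - δ) * ((L : ℝ) * ((L / 2 : ℕ) : ℝ)) / 2 ∧
          (1 - δ) * ((L : ℝ) * ((L / 2 : ℕ) : ℝ)) / 2 ≤ n + 3 / 8 := by
  obtain ⟨K₁, hK₁⟩ := exists_nat_gt (16 / (β - α))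
  obtain ⟨K₂, hK₂⟩ := exists_nat_gt (16 / α)
  obtain ⟨L, hLdef⟩ : ∃ L : ℕ, L = 4 * (L₀ + K₁ + K₂ + 2) := ⟨_, rfl⟩
  haveI iL : NeZero L := ⟨by omega⟩
  haveI iM : NeZero (L / 2) := ⟨by omega⟩
  have hLe : Even L := ⟨2 * (L₀ + K₁ + K₂ + 2), by omega⟩
  have hMe : Even (L / 2) := ⟨L₀ + K₁ + K₂ + 2, by omega⟩
  have hL8 : 8 ≤ L := by omega
  have hL8R : (8 : ℝ) ≤ L := by exact_mod_cast hL8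
  have hLpos : (0 : ℝ) < L := by linarith
  have hcast : ((L / 2 : ℕ) : ℝ) = (L : ℝ) / 2 := by
    have h2 : (((L / 2) * 2 : ℕ) : ℝ) = L := by rw [Nat.div_two_mul_two_of_even hLe]
    push_cast at h2
    linarith
  -- the site count `P = L · (L/2)` as a real number
  set P : ℝ := (L : ℝ) * ((L / 2 : ℕ) : ℝ) with hP
  have hPL : P = (L : ℝ) * L / 2 := by rw [hP, hcast]; ring
  have hP2 : (0 : ℝ) < P := by rw [hPL]; positivity
  have hLR : (K₁ : ℝ) ≤ L ∧ (K₂ : ℝ) ≤ L :=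
    ⟨by exact_mod_cast (by omega : K₁ ≤ L), by exact_mod_cast (by omega : K₂ ≤ L)⟩
  have hβα : 0 < β - α := sub_pos.2 hαβ
  -- `(β - α) L ≥ 16` and `α L ≥ 16`
  have h16 : 16 ≤ (β - α) * L := by
    have hK : 16 / (β - α) < L := hK₁.trans_le hLR.1
    have := (div_lt_iff₀ hβα).1 hK
    linarith
  have h16' : 16 ≤ α * L := by
    have hK : 16 / α < L := hK₂.trans_le hLR.2
    have := (div_lt_iff₀ hα).1 hK
    linarith
  have hroom : 4 * (L : ℝ) ≤ (β - α) * P / 2 := by rw [hPL]; nlinarith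
  have hαL : 4 * (L : ℝ) ≤ α * P / 2 := by rw [hPL]; nlinarith
  have hβL : 4 * (L : ℝ) ≤ β * P / 2 := by nlinarith [mul_nonneg hβα.le hP2.le]
  -- the negative levels: `2 #{ε < 0} + 2L ≥ L · (L/2)`
  set Neg := univ.filter fun k : ZMod L × ZMod (L / 2) => tubeBand L (L / 2) k < 0 with hNeg
  have hneg : L * (L / 2) ≤ 2 * Neg.card + 2 * L :=
    le_card_filter_tubeBand_neg (L := L) (M := L / 2) hLe hMe
  have hnegR : P ≤ 2 * (Neg.card : ℝ) + 2 * L := by rw [hP]; exact_mod_cast hneg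
  -- the largest negative level `vneg`; its closed shell is `{ε < 0}`
  have h00 : ((0 : ZMod L), (0 : ZMod (L / 2))) ∈ Neg := by
    rw [hNeg, mem_filter, tubeBand_zero_zero]; exact ⟨mem_univ _, by norm_num⟩
  have hNegne : Neg.Nonempty := ⟨_, h00⟩
  obtain ⟨k₀, hk₀, hk₀v⟩ :=
    Finset.mem_image.1 (Finset.max'_mem (Neg.image (tubeBand L (L / 2))) (hNegne.image _))
  set vneg := (Neg.image (tubeBand L (L / 2))).max' (hNegne.image _) with hvneg
  have hvneg0 : vneg < 0 := by
    rw [← hk₀v]; rw [hNeg] at hk₀; exact (mem_filter.1 hk₀).2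
  have hCv : (univ.filter fun k : ZMod L × ZMod (L / 2) => tubeBand L (L / 2) k ≤ vneg) = Neg := by
    ext k
    rw [hNeg, mem_filter, mem_filter]
    exact ⟨fun h => ⟨h.1, h.2.trans_lt hvneg0⟩,
      fun h => ⟨h.1, Finset.le_max' _ _ (mem_image_of_mem _ (by rw [hNeg]; exact mem_filter.2 h))⟩⟩
  -- the target count
  have h1β' : 0 ≤ 1 - β := by linarith
  have h1β : (0 : ℝ) ≤ (1 - β) * P / 2 := by positivity
  obtain ⟨t, ht⟩ : ∃ t : ℕ, t = ⌊(1 - β) * P / 2⌋₊ + 1 := ⟨_, rfl⟩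
  have ht0 : 0 < t := by omega
  have htlo : (1 - β) * P / 2 < t := by
    rw [ht]; push_cast; exact Nat.lt_floor_add_one _
  have hthi : (t : ℝ) ≤ (1 - β) * P / 2 + 1 := by
    rw [ht]; push_cast; linarith [Nat.floor_le h1β]
  have htNeg : t ≤ Neg.card := by
    have hR : (t : ℝ) ≤ (Neg.card : ℝ) := by linarith
    exact_mod_cast hR
  obtain ⟨μ, hμle, htμ, hμt⟩ := exists_closedShell_le (tubeBand L (L / 2)) (m := 2 * L)
    (card_filter_tubeBand_eq_le (L := L) (M := L / 2)) ht0 (v₀ := vneg) (by rw [hCv]; exact htNeg)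
  set n := (univ.filter fun k : ZMod L × ZMod (L / 2) => tubeBand L (L / 2) k ≤ μ).card with hn
  have hμ0 : μ < 0 := hμle.trans_lt hvneg0
  have hμ4 : -4 ≤ μ := by
    by_contra h
    rw [not_le] at h
    have h0 : (univ.filter fun k : ZMod L × ZMod (L / 2) => tubeBand L (L / 2) k ≤ μ) = ∅ :=
      Finset.filter_false_of_mem fun k _ => by
        have := neg_four_le_tubeBand (L := L) (M := L / 2) k; linarith
    have : n = 0 := by rw [hn, h0, card_empty]
    omega
  have hnR : (t : ℝ) ≤ n ∧ (n : ℝ) < t + 2 * L := ⟨by exact_mod_cast htμ, by exact_mod_cast hμt⟩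
  refine ⟨L, iL, iM, by omega, ⟨L₀ + K₁ + K₂ + 2, hLdef⟩, hL8,
    1 - 2 * ((n : ℝ) + 3 / 8) / P, 1 - 2 * ((n : ℝ) + 1 / 8) / P,
    ?_, ?_, ?_, n, μ, hμ0, hμ4, rfl, ?_⟩
  · -- `α < lo`
    have : 2 * ((n : ℝ) + 3 / 8) / P < 1 - α := by
      rw [div_lt_iff₀ hP2]; nlinarith
    linarith
  · -- `lo < hi`
    have : 2 * ((n : ℝ) + 1 / 8) / P < 2 * ((n : ℝ) + 3 / 8) / P := by
      apply div_lt_div_of_pos_right _ hP2; linarith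
    linarith
  · -- `hi < β`
    have : 1 - β < 2 * ((n : ℝ) + 1 / 8) / P := by
      rw [lt_div_iff₀ hP2]; nlinarith
    linarith
  · rintro δ ⟨hlo, hhi⟩
    constructor
    · have h1 : 2 * ((n : ℝ) + 1 / 8) / P ≤ 1 - δ := by linarith
      rw [div_le_iff₀ hP2] at h1
      linarith
    · have h1 : 1 - δ ≤ 2 * ((n : ℝ) + 3 / 8) / P := by linarith
      rw [le_div_iff₀ hP2] at h1
      linarith

/-- **One doping, cofinally many closed half-width shells.** There is ONE `δ ∈ (0, 3/10)` such that
for every `L₀` some `L ≥ L₀` with `4 ∣ L`, `L ≥ 8` has `(1-δ)·L·(L/2)/2 ∈ [n + 1/8, n + 3/8]` for a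
closed-shell count `n = #{ε_{L,L/2} ≤ μ}`, `-4 ≤ μ < 0`, of the free `L × L/2` tube — by NESTED CELLS:
iterate `exists_closedShell_cell_half` with thresholds `L₀ = 0, 1, 2, …`, each cell strictly inside the
previous one, and take `δ = sup` of the left end points. [folklore] -/
theorem exists_delta_closedShells_half :
    ∃ δ ∈ Set.Ioo (0 : ℝ) (3 / 10), ∀ L₀ : ℕ, ∃ (L : ℕ) (_ : NeZero L) (_ : NeZero (L / 2)),
      L₀ ≤ L ∧ 4 ∣ L ∧ 8 ≤ L ∧ ∃ (n : ℕ) (μ : ℝ), μ < 0 ∧ -4 ≤ μ ∧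
        (univ.filter fun k : ZMod L × ZMod (L / 2) => tubeBand L (L / 2) k ≤ μ).card = n ∧
        (n : ℝ) + 1 / 8 ≤ (1 - δ) * ((L : ℝ) * ((L / 2 : ℕ) : ℝ)) / 2 ∧
          (1 - δ) * ((L : ℝ) * ((L / 2 : ℕ) : ℝ)) / 2 ≤ n + 3 / 8 := by
  -- one step of the nesting
  have step : ∀ (p : {p : ℝ × ℝ // 0 < p.1 ∧ p.1 < p.2 ∧ p.2 < 3 / 10}) (j : ℕ),
      ∃ q : {p : ℝ × ℝ // 0 < p.1 ∧ p.1 < p.2 ∧ p.2 < 3 / 10}, p.1.1 < q.1.1 ∧ q.1.2 < p.1.2 ∧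
        ∃ (L : ℕ) (_ : NeZero L) (_ : NeZero (L / 2)), j ≤ L ∧ 4 ∣ L ∧ 8 ≤ L ∧
          ∃ (n : ℕ) (μ : ℝ), μ < 0 ∧ -4 ≤ μ ∧
          (univ.filter fun k : ZMod L × ZMod (L / 2) => tubeBand L (L / 2) k ≤ μ).card = n ∧
          ∀ δ ∈ Set.Icc q.1.1 q.1.2, (n : ℝ) + 1 / 8 ≤ (1 - δ) * ((L : ℝ) * ((L / 2 : ℕ) : ℝ)) / 2 ∧
            (1 - δ) * ((L : ℝ) * ((L / 2 : ℕ) : ℝ)) / 2 ≤ n + 3 / 8 := by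
    intro p j
    obtain ⟨L, iL, iM, hjL, h4, h8, lo, hi, hlo, hlohi, hhi, n, μ, hμ, hμ', hcard, hcell⟩ :=
      exists_closedShell_cell_half p.2.1 p.2.2.1 p.2.2.2 j
    exact ⟨⟨(lo, hi), p.2.1.trans hlo, hlohi, hhi.trans p.2.2.2⟩, hlo, hhi, L, iL, iM, hjL, h4, h8, n,
      μ, hμ, hμ', hcard, hcell⟩
  choose next hlo hhi hnext using step
  -- the nested sequence of windows, starting from `(1/10, 1/5)`
  set s : ℕ → {p : ℝ × ℝ // 0 < p.1 ∧ p.1 < p.2 ∧ p.2 < 3 / 10} := fun k =>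
    @Nat.rec (fun _ => {p : ℝ × ℝ // 0 < p.1 ∧ p.1 < p.2 ∧ p.2 < 3 / 10})
      ⟨((1 : ℝ) / 10, (1 : ℝ) / 5), by norm_num⟩ (fun j q => next q j) k with hs
  have hsucc : ∀ k, s (k + 1) = next (s k) k := fun k => rfl
  have hmono : StrictMono fun k => (s k).1.1 :=
    strictMono_nat_of_lt_succ fun k => by
      show (s k).1.1 < (s (k + 1)).1.1
      rw [hsucc]; exact hlo _ _
  have hanti : StrictAnti fun k => (s k).1.2 :=
    strictAnti_nat_of_succ_lt fun k => by
      show (s (k + 1)).1.2 < (s k).1.2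
      rw [hsucc]; exact hhi _ _
  have hlohi : ∀ j k, (s j).1.1 < (s k).1.2 := fun j k => by
    rcases le_total j k with h | h
    · exact (hmono.monotone h).trans_lt (s k).2.2.1
    · exact (s j).2.2.1.trans_le (hanti.antitone h)
  have hbdd : BddAbove (Set.range fun k => (s k).1.1) :=
    ⟨(s 0).1.2, by rintro _ ⟨k, rfl⟩; exact (hlohi k 0).le⟩
  obtain ⟨δ, hδ⟩ : ∃ δ : ℝ, δ = ⨆ k, (s k).1.1 := ⟨_, rfl⟩
  have hloδ : ∀ k, (s k).1.1 ≤ δ := fun k => by rw [hδ]; exact le_ciSup hbdd k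
  have hδhi : ∀ k, δ ≤ (s k).1.2 := fun k => by rw [hδ]; exact ciSup_le fun j => (hlohi j k).le
  refine ⟨δ, ⟨(s 0).2.1.trans_le (hloδ 0), (hδhi 0).trans_lt (s 0).2.2.2⟩, fun L₀ => ?_⟩
  obtain ⟨L, iL, iM, hL₀, h4, h8, n, μ, hμ, hμ', hcard, hcell⟩ := hnext (s L₀) L₀
  have hδcell : δ ∈ Set.Icc (next (s L₀) L₀).1.1 (next (s L₀) L₀).1.2 :=
    ⟨by rw [← hsucc]; exact hloδ (L₀ + 1), by rw [← hsucc]; exact hδhi (L₀ + 1)⟩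
  exact ⟨L, iL, iM, hL₀, h4, h8, n, μ, hμ, hμ', hcard, hcell δ hδcell⟩

end Cell

/-! ### At `U = 0` compressible parts glue into an incompressibility-free (degenerate) tube -/

section Headline

/-- **Positive parts, degenerate glued tube, at zero coupling.** There is a doping `δ ∈ (0, 3/10)` at
which, for EVERY threshold pair `(M₂, L₂)`, some admissible equal-width gluing beyond the thresholds —
two `L × L/2` tubes (`L ≡ 0 (mod 4)`, carrier `Fin`) into the square torus `L × L` — has, at `U = 0`,
both parts on a CLOSED shell (`ẽ″' = ẽ″'' > 0`, pair number `n = #{ε_{L,L/2} ≤ μ}`) and the glued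
tube on an OPEN shell (`ẽ″ = 0`: its pair number is exactly `2n`, even, and cumulative shell counts of
the even × even free torus are odd). [folklore] -/
theorem exists_cofinal_zero_coupling_guardedCompressibilityFailure :
    ∃ δ ∈ Set.Ioo (0 : ℝ) (3 / 10), ∀ M₂ L₂ : ℕ, ∃ (L : ℕ) (_ : NeZero L) (_ : NeZero (L / 2)),
      Even L ∧ Even (L / 2) ∧ M₂ ≤ L / 2 ∧ L / 2 + L / 2 = L ∧ L₂ ≤ L ∧
      0 < tubePairCompressibility L (L / 2) (Fin (L * (L / 2)))
          (finProdFinEquiv.symm.trans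
            (Equiv.prodCongr (ZMod.finEquiv L).toEquiv (ZMod.finEquiv (L / 2)).toEquiv)) 0 δ ∧
      tubePairCompressibility L L (Fin (L * L))
          (finProdFinEquiv.symm.trans
            (Equiv.prodCongr (ZMod.finEquiv L).toEquiv (ZMod.finEquiv L).toEquiv)) 0 δ = 0 := by
  obtain ⟨δ, hδ, hfam⟩ := exists_delta_closedShells_half
  refine ⟨δ, hδ, fun M₂ L₂ => ?_⟩
  obtain ⟨L, iL, iM, hL₀, ⟨j, hj⟩, h8, n, μ, hμ0, hμ4, hcard, hlo, hhi⟩ := hfam (L₂ + 2 * M₂ + 8)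
  have hLe : Even L := ⟨2 * j, by omega⟩
  have hMe : Even (L / 2) := ⟨j, by omega⟩
  have hL8 : (8 : ℝ) ≤ L := by exact_mod_cast h8
  have h1δ : 0 < 1 - δ := by linarith [hδ.2]
  have hcast : ((L / 2 : ℕ) : ℝ) = (L : ℝ) / 2 := by
    have h2 : (((L / 2) * 2 : ℕ) : ℝ) = L := by rw [Nat.div_two_mul_two_of_even hLe]
    push_cast at h2
    linarith
  have hL2 : (0 : ℝ) < (L : ℝ) * L := by positivity
  -- parts filling `2n`
  have hnn' : (0 : ℝ) ≤ (1 - δ) * ((L : ℝ) * ((L / 2 : ℕ) : ℝ)) / 2 := by positivity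
  have hfillM : tubeFilling L (L / 2) δ = 2 * n := by
    rw [tubeFilling]
    congr 1
    rw [Nat.floor_eq_iff hnn']
    constructor <;> linarith
  -- glued filling `2 · 2n`
  rw [hcast] at hlo hhi
  have hnn : (0 : ℝ) ≤ (1 - δ) * ((L : ℝ) * L) / 2 := by positivity
  have hfillL : tubeFilling L L δ = 2 * (2 * n) := by
    rw [tubeFilling]
    congr 1
    rw [Nat.floor_eq_iff hnn]
    push_cast
    constructor <;> nlinarith
  -- sizes: `0 < n`, `n < L · (L/2)`, `2n < L²`
  have h64 : (64 : ℝ) ≤ (L : ℝ) * L := by nlinarith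
  have h07 : (7 / 10 : ℝ) * ((L : ℝ) * L) ≤ (1 - δ) * ((L : ℝ) * L) :=
    mul_le_mul_of_nonneg_right (by linarith [hδ.2]) hL2.le
  have hnpos : (0 : ℝ) < n := by nlinarith
  have hn0 : 0 < n := by exact_mod_cast hnpos
  have hδL : 0 < δ * ((L : ℝ) * L) := mul_pos hδ.1 hL2
  have hnlt : n < L * (L / 2) := by
    have h' : (n : ℝ) < (L : ℝ) * ((L / 2 : ℕ) : ℝ) := by rw [hcast]; nlinarith
    exact_mod_cast h'
  have h2n : 2 * n < L * L := by
    have h' : 2 * (n : ℝ) < (L : ℝ) * L := by nlinarith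
    exact_mod_cast h'
  refine ⟨L, iL, iM, hLe, hMe, by omega, by omega, by omega, ?_, ?_⟩
  · exact tubePairCompressibility_zero_coupling_pos_of_closedShell _ (by omega) (by omega) hfillM hcard
      hn0 hnlt
  · exact tubePairCompressibility_zero_coupling_eq_zero_of_even _ hLe hLe (by omega) (by omega) hfillL
      (even_two_mul n) (by omega) h2n

/-- **Even the sign-guarded compressibility comparison of `SeamGluingLocality` fails at zero coupling
(stmt-HubbardSuperconductivity-18509).** Conjunct (2) of the crux with its guard made a hypothesis —
`0 < min(ẽ″', ẽ″'') → (1 - M₂/M)·min(ẽ″', ẽ″'') ≤ ẽ″_M`, the "positive parts, comparison only"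
reading of the item and the compressibility half of the guarded repair shape "C‴" — is FALSE at
`U = 0`: at the doping of `exists_cofinal_zero_coupling_guardedCompressibilityFailure`, whatever the
thresholds `(M₂, L₂)`, two compressible free `L × L/2` tubes (`ẽ″' = ẽ″'' > 0`) glue into the free
square torus with `ẽ″ = 0 < (1 - M₂/L)·ẽ″'`. Reading: unlike the witness of
`seamGluingLocality_false_at_zero_coupling` (parts with `ẽ″ = 0`, excluded by the guard), this one
survives the guard, so the `U = 0` failure of the crux is not an artefact of its hidden degeneracy
claim — locality of a positive pair compressibility is an INTERACTION statement; a restatement is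
consistent at `U → 0⁺` only through per-width floor hypotheses at the same `(U, δ)` (false at `U = 0`)
and thresholds `m₀, L₂ → ∞`. The crux itself (`0 < U`) is untouched. [folklore] -/
theorem guardedCompressibilityLocality_false_at_zero_coupling :
    ¬ ∀ δ ∈ Set.Ioo (0 : ℝ) (3 / 10), ∃ M₂ L₂ : ℕ,
        ∀ (L M' M'' M : ℕ) [NeZero L] [NeZero M'] [NeZero M''] [NeZero M], Even L → Even M' →
          Even M'' → M₂ ≤ M' → M₂ ≤ M'' → M' + M'' = M → M ≤ L → L₂ ≤ L →
            ∀ (Λ' : Type) [LinearOrder Λ'] [Fintype Λ'] (e' : Λ' ≃ ZMod L × ZMod M')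
              (Λ'' : Type) [LinearOrder Λ''] [Fintype Λ''] (e'' : Λ'' ≃ ZMod L × ZMod M'')
              (Λ : Type) [LinearOrder Λ] [Fintype Λ] (e : Λ ≃ ZMod L × ZMod M),
              0 < min (tubePairCompressibility L M' Λ' e' 0 δ) (tubePairCompressibility L M'' Λ'' e'' 0 δ) →
                (1 - (M₂ : ℝ) / M) *
                    min (tubePairCompressibility L M' Λ' e' 0 δ) (tubePairCompressibility L M'' Λ'' e'' 0 δ) ≤
                  tubePairCompressibility L M Λ e 0 δ := by
  intro h
  obtain ⟨δ, hδ, hfam⟩ := exists_cofinal_zero_coupling_guardedCompressibilityFailure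
  obtain ⟨M₂, L₂, hC⟩ := h δ hδ
  obtain ⟨L, iL, iM, hLe, hMe, hM₂, hsum, hL₂, hpos, hzero⟩ := hfam M₂ L₂
  have h2 := hC L (L / 2) (L / 2) L hLe hMe hMe hM₂ hM₂ hsum le_rfl hL₂ (Fin (L * (L / 2)))
    (finProdFinEquiv.symm.trans (Equiv.prodCongr (ZMod.finEquiv L).toEquiv (ZMod.finEquiv (L / 2)).toEquiv))
    (Fin (L * (L / 2))) (finProdFinEquiv.symm.trans
      (Equiv.prodCongr (ZMod.finEquiv L).toEquiv (ZMod.finEquiv (L / 2)).toEquiv)) (Fin (L * L))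
    (finProdFinEquiv.symm.trans (Equiv.prodCongr (ZMod.finEquiv L).toEquiv (ZMod.finEquiv L).toEquiv))
  rw [min_self, hzero] at h2
  have hL0 : 0 < L := NeZero.pos L
  have hL0R : (0 : ℝ) < L := by exact_mod_cast hL0
  have hML : (M₂ : ℝ) / L < 1 := by
    rw [div_lt_one hL0R]
    exact_mod_cast (by omega : M₂ < L)
  have h3 := h2 hpos
  nlinarith [mul_pos (sub_pos.2 hML) hpos]

/-- The same with the coupling quantified as in the disprover's `…FromZeroU` near-misses
(`∀ U, 0 ≤ U → …`): the sign-guarded compressibility comparison over the tube names with `0 ≤ U`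
admitted is FALSE (take `U = 0`). [folklore] -/
theorem not_guardedCompressibilityLocality_fromZeroU :
    ¬ ∀ U : ℝ, 0 ≤ U → ∀ δ ∈ Set.Ioo (0 : ℝ) (3 / 10), ∃ M₂ L₂ : ℕ,
        ∀ (L M' M'' M : ℕ) [NeZero L] [NeZero M'] [NeZero M''] [NeZero M], Even L → Even M' →
          Even M'' → M₂ ≤ M' → M₂ ≤ M'' → M' + M'' = M → M ≤ L → L₂ ≤ L →
            ∀ (Λ' : Type) [LinearOrder Λ'] [Fintype Λ'] (e' : Λ' ≃ ZMod L × ZMod M')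
              (Λ'' : Type) [LinearOrder Λ''] [Fintype Λ''] (e'' : Λ'' ≃ ZMod L × ZMod M'')
              (Λ : Type) [LinearOrder Λ] [Fintype Λ] (e : Λ ≃ ZMod L × ZMod M),
              0 < min (tubePairCompressibility L M' Λ' e' U δ) (tubePairCompressibility L M'' Λ'' e'' U δ) →
                (1 - (M₂ : ℝ) / M) *
                    min (tubePairCompressibility L M' Λ' e' U δ) (tubePairCompressibility L M'' Λ'' e'' U δ) ≤
                  tubePairCompressibility L M Λ e U δ := by
  intro h
  exact guardedCompressibilityLocality_false_at_zero_coupling fun δ hδ => h 0 le_rfl δ hδ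

end Headline

end Summit.HubbardSuperconductivity.HubbardSuperconductivity.Theorems.SeamGluingLocality.Negative

end
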